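import Summits.QuantumFields.BalabanUV.T4Continuum.Support.ShellMeasureAverageIterate

/-!
# `T4Continuum.ShellMeasureAverageIteratePower` — [B7] PROP. 6 (164) SHAPE FOR THE (0.12)∕(15) AVERAGE, file 2∕3: the
# `k`-fold ITERATE `avgIter` of the printed one-step average, the ITERATE IDENTITY «`\overline{V′U₀}ᵏ(c) =
# exp(i·Q_k(B′)(c))·Ū₀ᵏ(c)`» on the chart ball, and the (164) SHAPE `‖\overline{V′U₀}ᵏ(c)·(Ū₀ᵏ(c))⁻¹ − 1‖ ≤ e^{Mᵏ‖B′‖} − 1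
# ≤ 2Mᵏ‖B′‖` (cell `pub-balaban`, sub-cell `t4`, spine estimate NE7c (node U5b); NE7c ROUND-2 crew `t4-ne7c-formalise-*`,
# unit `b2b-balaban-t4-ne7c-formalise-leaf-06` gen 3, owner table `LEAVES-NE7c-P1.md` row S57 (LOWER priority than S55∕S56);
# ADDITIVE — imports file 1 `ShellMeasureAverageIterate` only; 0 sorry, 0 cite tags)

HONEST FRAMING.  Finite four-torus programme, rung (B)+1 only — NOT infinite volume, NOT a mass gap, NOT the Clay
problem, NOT summit progress.  NE7c is NOT PRINTED and NOT PROVED; «NE7c ⇐ the named binders».  ELEMENTARY ([folklore]);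
nothing printed is asserted: [Balaban1985Averaging] Prop. 6 p. 43 / (164) is the SHAPE, reproduced for the tree's
average `B12AverageCorridor267.avgM` with the printed contours `gammaT` by composition of the owner's one-step facts (row
S49), with the two honest differences of file 1's header DISPLAYED: (i) the chart radius `M⁻¹M⁻ᵏ`, `M = 2816(d+1)L`,
shrinks geometrically in `k` (print: `k`-uniform `α₁`, via Prop. 3's sharp linear part — rows S55∕S56); (ii) the
regularity of the averaged backgrounds `avgIter L U₀ j` at every level (unit bounds, `ε`-regular off-axis block loops,
`ε ≤ 1∕8`) is a DISPLAYED hypothesis (print: Props 1–2).  v1.1 NOTE (XREAD C-ne7cleaf09-35, OBJECTION-1, statement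
shape): the binders below are quantified over ALL levels `j`, but print's (52) (tree: `B7Prop2Explicit`, transported by
row S59 `ShellMeasureAverageIterateRegular`) controls the averaged backgrounds only for `j ≤ k` — so THESE statements are
not reachable from (52); the `∀ j < k` variants with the SAME proofs (`avgIter_pert_eq_of_lt`,
`norm_avgIter_quot_sub_one_le_of_lt`) and their discharge from (52) alone (`avgIter_pert_eq_of_prop2`, …, for `U(N)`-valued
`U₀`) are file 3 `ShellMeasureAverageIterateEnd` (p220136); nothing below is changed.  HONEST DEPENDENCY (cell):
continuum YM on T⁴ ⇐ BetaPertH ∧ nine spine estimates (0/9 proved); BetaPertH ⇐ (D1) ∧ (D4) ∧ CAP+tail; G-an2-4 gates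
asym, D1 and NE2/3/4.

## What is proved (all [folklore])

* §1 `val_quot_eq` (the quotient `M(V′V)(c)M(V)(c)⁻¹` IS S49 f1's quotient for f2's exponent∕transporter — definitional),
  `norm_avgM_quot_sub_one_le_half` (`≤ 1∕2` on the ball `‖B′‖ < M⁻¹`, S49's Schwarz device), **`avgM_pert_eq_exp_mul`**:
  (2.4) READ FORWARDS, ONE STEP — `M(V′V)(c) = exp(i·Q̃_V(B′)(c))·M(V)(c)` on the ball (`MatrixLog.exp_mlog`).
* §2 `avgIter L U j` — the `j`-fold iterate of the (15)-average (corner cubes: the coarse lattice is `ℤᵈ` again) —;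
  **`avgIter_pert_eq`**: on the pyramid `T` of file 1, with backgrounds `avgIter L U₀ j`, for `‖B‖ < M⁻¹M⁻ᵏ` and `c ∈ T k`,
  `avgIter L (pert (ext B) U₀) k c = pert (ext (chartIter k B)) (avgIter L U₀ k) c` (induction; block locality
  `avgM_congr` + §1 at every level, the chart iterate staying in the one-step ball by file 1's `norm_chartIter_le`);
  `exp_chartIter_mul_avgIter` — the same as `exp(i·(Q_k B)(c))·Ū₀ᵏ(c) = \overline{V′U₀}ᵏ(c)` in `𝔸`;
  **`norm_avgIter_quot_sub_one_le`** ((164) SHAPE, exponential form) and **`norm_avgIter_quot_sub_one_le_linear`**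
  (`≤ 2Mᵏ‖B‖`, since `Mᵏ‖B‖ ≤ M⁻¹ ≤ 1`).

WHAT THIS DOES NOT DO.  See file 1: no `k`-uniform domain, no regularity of the averaged backgrounds, no (0.4)∕(0.11), no
complex backgrounds (Prop. 7); NE7c NOT proved; 0/9 spine.
-/

noncomputable section

open NormedSpace Metric Set

namespace Summit.QuantumFields.BalabanUV.T4Continuum.ShellMeasureAverageIteratePower

open Literature.MathematicalPhysics.QuantumFieldTheory.Balaban1983to89
open Literature.MathematicalPhysics.QuantumLattice (ZdEdge blockSites)
open B7BlockGeometry (qppBonds)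
open B12HOperator267 (gammaT)
open B12AverageCorridor267 (expU val_expU pert pert_apply pert_zero avgM avgM_congr Ustr Qtilde Qtilde_congr
  isBlockLocal_gammaT loopW offAxis)
open MatrixLog (mlog exp_mlog)
open Literature.Analysis.Calculus (norm_exp_sub_one_le)
open ShellMeasureAverageAnalytic
open ShellMeasureAverageAnalyticB7 (extend_val pert_extend_zero expWord_Ustr expWord_gammaT exponent_analytic_and_bounded
  loops_small_gammaT radii_numerics)
open ShellMeasureAverageIterate (ext ext_apply_mem restr restr_apply norm_restr_le Qtilde_ext_eq_of_subset chartStep chartIter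
  chartIter_zero_apply chartIter_succ_apply norm_chartIter_le)

/-! ## §1 (2.4) read forwards, one step -/

section Identity

variable {d : ℕ} {𝔸 : Type*} [NormedRing 𝔸] [NormedAlgebra ℂ 𝔸] [CompleteSpace 𝔸] [NormOneClass 𝔸] {L : ℕ}
  {c : ZdEdge d} {V : ZdEdge d → 𝔸ˣ}

omit [NormOneClass 𝔸] in
/-- the quotient `M(V′V)(c)·M(V)(c)⁻¹` IS file 1's quotient `e^{S(B)}T(B)(e^{S(0)}T(0))⁻¹` for S49 f2's exponent and
transporter (definitional, after `pert (ext 0) V = V`). [folklore] -/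
theorem val_quot_eq (V : ZdEdge d → 𝔸ˣ) (B : ↥(qppBonds L c) → 𝔸) :
    ((avgM L (fun U : ZdEdge d → 𝔸ˣ => gammaT L U) (pert (Function.extend Subtype.val B (0 : ZdEdge d → 𝔸)) V) c *
        (avgM L (fun U : ZdEdge d → 𝔸ˣ => gammaT L U) V c)⁻¹ : 𝔸ˣ) : 𝔸)
      = (((expU ((fun B : ↥(qppBonds L c) → 𝔸 => ∑ x ∈ blockSites L c.1, (((L : ℂ) ^ d)⁻¹ : ℂ) •
            mlog ((loopW L (fun U : ZdEdge d → 𝔸ˣ => gammaT L U)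
              (pert (Function.extend Subtype.val B (0 : ZdEdge d → 𝔸)) V) c x : 𝔸ˣ) : 𝔸)) B) *
          (fun B : ↥(qppBonds L c) → 𝔸 =>
            Ustr L (pert (Function.extend Subtype.val B (0 : ZdEdge d → 𝔸)) V) c) B) *
          (expU ((fun B : ↥(qppBonds L c) → 𝔸 => ∑ x ∈ blockSites L c.1, (((L : ℂ) ^ d)⁻¹ : ℂ) •
            mlog ((loopW L (fun U : ZdEdge d → 𝔸ˣ => gammaT L U)
              (pert (Function.extend Subtype.val B (0 : ZdEdge d → 𝔸)) V) c x : 𝔸ˣ) : 𝔸)) 0) *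
          (fun B : ↥(qppBonds L c) → 𝔸 =>
            Ustr L (pert (Function.extend Subtype.val B (0 : ZdEdge d → 𝔸)) V) c) 0)⁻¹ : 𝔸ˣ) : 𝔸) := by
  simp only [pert_extend_zero]
  rfl

variable (hL : 0 < L) (hV : ∀ b, ‖((V b : 𝔸ˣ) : 𝔸)‖ ≤ 1) (hV' : ∀ b, ‖(((V b)⁻¹ : 𝔸ˣ) : 𝔸)‖ ≤ 1)
  {ε : ℝ} (hε0 : 0 ≤ ε) (hε : ε ≤ 1 / 8)
  (hW : ∀ x ∈ offAxis L c, ‖((loopW L (fun U : ZdEdge d → 𝔸ˣ => gammaT L U) V c x : 𝔸ˣ) : 𝔸) - 1‖ ≤ ε)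
include hL hV hV' hε0 hε hW

/-- On the ball the quotient `M(V′V)(c)·M(V)(c)⁻¹` is `1∕2`-close to `1` (S49's Schwarz device
`norm_quot_sub_one_le_half` with f2's exponent∕transporter facts for the printed contours). [folklore] -/
theorem norm_avgM_quot_sub_one_le_half {B : ↥(qppBonds L c) → 𝔸} (hB : ‖B‖ < 1 / (2816 * ((d : ℝ) + 1) * L)) :
    ‖((avgM L (fun U : ZdEdge d → 𝔸ˣ => gammaT L U) (pert (Function.extend Subtype.val B (0 : ZdEdge d → 𝔸)) V) c *
        (avgM L (fun U : ZdEdge d → 𝔸ˣ => gammaT L U) V c)⁻¹ : 𝔸ˣ) : 𝔸) - 1‖ ≤ 1 / 2 := by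
  have hLr : (1 : ℝ) ≤ L := by exact_mod_cast hL
  have hdL : (0 : ℝ) ≤ d * L := by positivity
  have hw : (2 : ℝ) ≤ 2 * (d * L) + 2 * L := by linarith
  obtain ⟨-, hK, -⟩ := radii_numerics (wT := (L : ℝ)) hw (by linarith) hε
  have hR₁ : (0 : ℝ) < 1 / (32 * (2 * (d * L) + 2 * L)) := by positivity
  have hR : (1 : ℝ) / (1408 * (2 * (d * L) + 2 * L)) ≤ 1 / (32 * (2 * (d * L) + 2 * L)) :=
    one_div_le_one_div_of_le (by positivity) (by nlinarith)
  have hr : (1 : ℝ) / (1408 * (2 * (d * L) + 2 * L)) = 1 / (2816 * ((d : ℝ) + 1) * L) := by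
    congr 1; ring
  have hB' : ‖B‖ < 1 / (1408 * (2 * ((d : ℝ) * L) + 2 * L)) := by rwa [hr]
  have hexp := fun B' (hB' : ‖B'‖ < 1 / (32 * (2 * ((d : ℝ) * L) + 2 * L))) =>
    exponent_analytic_and_bounded (c := c) (𝒯 := fun U : ZdEdge d → 𝔸ˣ => gammaT L U) hL hV hV' (by positivity)
      (expWord_gammaT hL hV hV') hε (loops_small_gammaT hL hε0 hW) B' hB'
  rw [val_quot_eq]
  exact norm_quot_sub_one_le_half (expWord_Ustr hV hV' c) hR₁ (fun B' hB' => (hexp B' hB').1)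
    (fun B' hB' => (hexp B' hB').2) hR hK hB'

/-- **(2.4) READ FORWARDS, ONE STEP**: on the ball, `M(V′V)(c) = exp(i·Q̃_V(B′)(c))·M(V)(c)` — `exp ∘ log = id` on
the disc (`MatrixLog.exp_mlog`) once the quotient is `1∕2`-close to `1`. [folklore] -/
theorem avgM_pert_eq_exp_mul {B : ↥(qppBonds L c) → 𝔸} (hB : ‖B‖ < 1 / (2816 * ((d : ℝ) + 1) * L)) :
    ((avgM L (fun U : ZdEdge d → 𝔸ˣ => gammaT L U) (pert (Function.extend Subtype.val B (0 : ZdEdge d → 𝔸)) V) c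
        : 𝔸ˣ) : 𝔸)
      = exp (Complex.I • Qtilde L (fun U : ZdEdge d → 𝔸ˣ => gammaT L U) V
            (Function.extend Subtype.val B (0 : ZdEdge d → 𝔸)) c) *
          ((avgM L (fun U : ZdEdge d → 𝔸ˣ => gammaT L U) V c : 𝔸ˣ) : 𝔸) := by
  set Mp := avgM L (fun U : ZdEdge d → 𝔸ˣ => gammaT L U) (pert (Function.extend Subtype.val B (0 : ZdEdge d → 𝔸)) V) c
    with hMp
  set M0 := avgM L (fun U : ZdEdge d → 𝔸ˣ => gammaT L U) V c with hM0
  have hZ : ‖((Mp * M0⁻¹ : 𝔸ˣ) : 𝔸) - 1‖ < 1 :=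
    (norm_avgM_quot_sub_one_le_half hL hV hV' hε0 hε hW hB).trans_lt (by norm_num)
  have hQ : Complex.I • Qtilde L (fun U : ZdEdge d → 𝔸ˣ => gammaT L U) V
      (Function.extend Subtype.val B (0 : ZdEdge d → 𝔸)) c = mlog ((Mp * M0⁻¹ : 𝔸ˣ) : 𝔸) := by
    show Complex.I • ((-Complex.I) • mlog ((Mp * M0⁻¹ : 𝔸ˣ) : 𝔸)) = _
    rw [smul_smul, mul_neg, Complex.I_mul_I, neg_neg, one_smul]
  rw [hQ, exp_mlog hZ, Units.val_mul, mul_assoc, Units.inv_mul, mul_one]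

end Identity

/-! ## §2 The `k`-fold iterate of the average, the iterate identity, and the (164) SHAPE -/

section Power

variable {d : ℕ} {𝔸 : Type*} [NormedRing 𝔸] [NormedAlgebra ℂ 𝔸] [CompleteSpace 𝔸] [NormOneClass 𝔸] {L : ℕ}

variable (L) in
/-- THE `j`-FOLD ITERATE OF THE PRINTED ONE-STEP AVERAGE (15): coarse bonds of level `j` index `ℤᵈ` again (corner
cubes), so the one-step average composes with itself. [folklore] -/
def avgIter (U : ZdEdge d → 𝔸ˣ) : ℕ → ZdEdge d → 𝔸ˣ
  | 0 => U
  | j + 1 => fun c => avgM L (fun W : ZdEdge d → 𝔸ˣ => gammaT L W) (avgIter U j) c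

omit [NormOneClass 𝔸] in
/-- unfolding at `0`. [folklore] -/
@[simp] theorem avgIter_zero (U : ZdEdge d → 𝔸ˣ) : avgIter L U 0 = U := rfl

omit [NormOneClass 𝔸] in
/-- unfolding at `j + 1`. [folklore] -/
theorem avgIter_succ (U : ZdEdge d → 𝔸ˣ) (j : ℕ) (c : ZdEdge d) :
    avgIter L U (j + 1) c = avgM L (fun W : ZdEdge d → 𝔸ˣ => gammaT L W) (avgIter L U j) c := rfl

variable {T : ℕ → Finset (ZdEdge d)} {U₀ : ZdEdge d → 𝔸ˣ}
  (hL : 0 < L) (hT : ∀ j, ∀ c ∈ T (j + 1), qppBonds L c ⊆ T j)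
  (hV : ∀ j b, ‖((avgIter L U₀ j b : 𝔸ˣ) : 𝔸)‖ ≤ 1) (hV' : ∀ j b, ‖(((avgIter L U₀ j b)⁻¹ : 𝔸ˣ) : 𝔸)‖ ≤ 1)
  {ε : ℝ} (hε0 : 0 ≤ ε) (hε : ε ≤ 1 / 8)
  (hW : ∀ j, ∀ c ∈ T (j + 1), ∀ x ∈ offAxis L c,
    ‖((loopW L (fun U : ZdEdge d → 𝔸ˣ => gammaT L U) (avgIter L U₀ j) c x : 𝔸ˣ) : 𝔸) - 1‖ ≤ ε)
include hL hT hV hV' hε0 hε hW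

/-- **THE ITERATE IDENTITY** ([B7] Prop. 6's `\overline{U′U₀}ᵏ = Ũ′ᵏ·Ū₀ᵏ` SHAPE for (15)): for `‖B‖ < M⁻¹M⁻ᵏ` and
`c ∈ T k`, the `k`-fold average of the perturbed configuration `pert (ext B) U₀` at `c` is
`exp(i·(chartIter k B)(c))` times the `k`-fold average of `U₀` — with the averaged backgrounds `avgIter L U₀ j` ASSUMED
unit-bounded with `ε`-regular off-axis block loops at every level (displayed). [folklore] -/
theorem avgIter_pert_eq (k : ℕ) {B : ↥(T 0) → 𝔸}
    (hB : B ∈ ball (0 : ↥(T 0) → 𝔸) (1 / (2816 * ((d : ℝ) + 1) * L) / (2816 * ((d : ℝ) + 1) * L) ^ k))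
    {c : ZdEdge d} (hc : c ∈ T k) :
    avgIter L (pert (ext (T 0) B) U₀) k c
      = pert (ext (T k) (chartIter L T (avgIter L U₀) k B)) (avgIter L U₀ k) c := by
  have hLr : (1 : ℝ) ≤ L := by exact_mod_cast hL
  have hM1 : (1 : ℝ) ≤ 2816 * ((d : ℝ) + 1) * L := by nlinarith [(Nat.cast_nonneg d : (0 : ℝ) ≤ d)]
  have hM0 : (0 : ℝ) < 2816 * ((d : ℝ) + 1) * L := lt_of_lt_of_le one_pos hM1
  have hr0 : (0 : ℝ) < 1 / (2816 * ((d : ℝ) + 1) * L) := by positivity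
  induction k generalizing c with
  | zero =>
    rw [avgIter_zero, avgIter_zero, chartIter_zero_apply]
  | succ k ih =>
    -- the smaller ball sits inside the previous one, and `chartIter k B` restricted to `B(c₋) ∪ B(c₊)` is in the
    -- one-step ball
    have hpow : (0 : ℝ) < (2816 * ((d : ℝ) + 1) * L) ^ k := pow_pos hM0 k
    have hBk : B ∈ ball (0 : ↥(T 0) → 𝔸) (1 / (2816 * ((d : ℝ) + 1) * L) / (2816 * ((d : ℝ) + 1) * L) ^ k) := by
      rw [mem_ball_zero_iff] at hB ⊢
      refine hB.trans_le (div_le_div_of_nonneg_left hr0.le hpow ?_)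
      rw [pow_succ]
      exact le_mul_of_one_le_right hpow.le hM1
    have hQk : ‖restr (hT k c hc) (chartIter L T (avgIter L U₀) k B)‖ < 1 / (2816 * ((d : ℝ) + 1) * L) := by
      refine (norm_restr_le _ _).trans_lt ?_
      have hb := norm_chartIter_le hL hT hV hV' hε0 hε hW k hBk
      rw [mem_ball_zero_iff] at hB
      calc ‖chartIter L T (avgIter L U₀) k B‖ ≤ (2816 * ((d : ℝ) + 1) * L) ^ k * ‖B‖ := hb
        _ < (2816 * ((d : ℝ) + 1) * L) ^ k *
              (1 / (2816 * ((d : ℝ) + 1) * L) / (2816 * ((d : ℝ) + 1) * L) ^ (k + 1)) :=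
            mul_lt_mul_of_pos_left hB hpow
        _ = 1 / (2816 * ((d : ℝ) + 1) * L) / (2816 * ((d : ℝ) + 1) * L) := by rw [pow_succ]; field_simp
        _ ≤ 1 / (2816 * ((d : ℝ) + 1) * L) := div_le_self hr0.le hM1
    -- the level-`k` perturbed average agrees with `pert (ext (chartIter k B)) (avgIter U₀ k)` on `B(c₋) ∪ B(c₊)`
    have hagree : ∀ b ∈ qppBonds L c, avgIter L (pert (ext (T 0) B) U₀) k b =
        pert (Function.extend Subtype.val (restr (hT k c hc) (chartIter L T (avgIter L U₀) k B)) (0 : ZdEdge d → 𝔸))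
          (avgIter L U₀ k) b := fun b hb => by
      rw [ih hBk (hT k c hc hb), pert_apply, pert_apply, ext_apply_mem _ (hT k c hc hb),
        extend_val _ ⟨b, hb⟩, restr_apply]
    apply Units.ext
    rw [avgIter_succ, avgM_congr hL (isBlockLocal_gammaT hL) hagree,
      avgM_pert_eq_exp_mul hL (hV k) (hV' k) hε0 hε (hW k c hc) hQk, pert_apply, Units.val_mul, val_expU,
      avgIter_succ, ext_apply_mem _ hc, chartIter_succ_apply]
    congr 2
    exact congrArg _ (Qtilde_ext_eq_of_subset hL (hT k c hc) (avgIter L U₀ k) (chartIter L T (avgIter L U₀) k B)).symm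

/-- … in the shape the owner typed for row S57: `exp(i·(Q_k B)(c))·Ū₀ᵏ(c) = \overline{V′U₀}ᵏ(c)` (values in `𝔸`).
[folklore] -/
theorem exp_chartIter_mul_avgIter (k : ℕ) {B : ↥(T 0) → 𝔸}
    (hB : B ∈ ball (0 : ↥(T 0) → 𝔸) (1 / (2816 * ((d : ℝ) + 1) * L) / (2816 * ((d : ℝ) + 1) * L) ^ k))
    {c : ZdEdge d} (hc : c ∈ T k) :
    exp (Complex.I • chartIter L T (avgIter L U₀) k B ⟨c, hc⟩) * ((avgIter L U₀ k c : 𝔸ˣ) : 𝔸)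
      = ((avgIter L (pert (ext (T 0) B) U₀) k c : 𝔸ˣ) : 𝔸) := by
  rw [avgIter_pert_eq hL hT hV hV' hε0 hε hW k hB hc, pert_apply, Units.val_mul, val_expU, ext_apply_mem _ hc]

/-- **(164) SHAPE**: for `‖B‖ < M⁻¹M⁻ᵏ` and `c ∈ T k`, the `k`-fold average of the perturbed configuration RELATIVE
to that of the background is `e^{Mᵏ‖B‖}−1`-close to `1`:
`‖\overline{V′U₀}ᵏ(c)·(Ū₀ᵏ(c))⁻¹ − 1‖ ≤ exp(Mᵏ‖B‖) − 1`, `M = 2816(d+1)L` (print: `< O(1)α₁` with a `k`-uniform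
domain — honest difference (i) of the header). [folklore] -/
theorem norm_avgIter_quot_sub_one_le (k : ℕ) {B : ↥(T 0) → 𝔸}
    (hB : B ∈ ball (0 : ↥(T 0) → 𝔸) (1 / (2816 * ((d : ℝ) + 1) * L) / (2816 * ((d : ℝ) + 1) * L) ^ k))
    {c : ZdEdge d} (hc : c ∈ T k) :
    ‖((avgIter L (pert (ext (T 0) B) U₀) k c * (avgIter L U₀ k c)⁻¹ : 𝔸ˣ) : 𝔸) - 1‖
      ≤ Real.exp ((2816 * ((d : ℝ) + 1) * L) ^ k * ‖B‖) - 1 := by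
  rw [avgIter_pert_eq hL hT hV hV' hε0 hε hW k hB hc, pert_apply, mul_inv_cancel_right, val_expU]
  refine (norm_exp_sub_one_le _).trans ?_
  rw [norm_smul, Complex.norm_I, one_mul, ext_apply_mem _ hc]
  exact sub_le_sub_right (Real.exp_le_exp.2 ((norm_le_pi_norm _ _).trans
    (norm_chartIter_le hL hT hV hV' hε0 hε hW k hB))) 1

/-- … in particular LINEARLY: `≤ 2·Mᵏ‖B‖` (since `Mᵏ‖B‖ < M⁻¹ ≤ 1` and `eᵗ − 1 ≤ t + t² ≤ 2t` on `[0,1]`). [folklore] -/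
theorem norm_avgIter_quot_sub_one_le_linear (k : ℕ) {B : ↥(T 0) → 𝔸}
    (hB : B ∈ ball (0 : ↥(T 0) → 𝔸) (1 / (2816 * ((d : ℝ) + 1) * L) / (2816 * ((d : ℝ) + 1) * L) ^ k))
    {c : ZdEdge d} (hc : c ∈ T k) :
    ‖((avgIter L (pert (ext (T 0) B) U₀) k c * (avgIter L U₀ k c)⁻¹ : 𝔸ˣ) : 𝔸) - 1‖
      ≤ 2 * ((2816 * ((d : ℝ) + 1) * L) ^ k * ‖B‖) := by
  have hLr : (1 : ℝ) ≤ L := by exact_mod_cast hL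
  have hM1 : (1 : ℝ) ≤ 2816 * ((d : ℝ) + 1) * L := by nlinarith [(Nat.cast_nonneg d : (0 : ℝ) ≤ d)]
  have hM0 : (0 : ℝ) < 2816 * ((d : ℝ) + 1) * L := lt_of_lt_of_le one_pos hM1
  have hpow : (0 : ℝ) < (2816 * ((d : ℝ) + 1) * L) ^ k := pow_pos hM0 k
  set t := (2816 * ((d : ℝ) + 1) * L) ^ k * ‖B‖ with ht
  have ht0 : 0 ≤ t := mul_nonneg hpow.le (norm_nonneg B)
  have ht1 : t ≤ 1 := by
    rw [mem_ball_zero_iff] at hB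
    have h1 : t ≤ (2816 * ((d : ℝ) + 1) * L) ^ k *
        (1 / (2816 * ((d : ℝ) + 1) * L) / (2816 * ((d : ℝ) + 1) * L) ^ k) :=
      mul_le_mul_of_nonneg_left hB.le hpow.le
    have h2 : (2816 * ((d : ℝ) + 1) * L) ^ k * (1 / (2816 * ((d : ℝ) + 1) * L) / (2816 * ((d : ℝ) + 1) * L) ^ k)
        = 1 / (2816 * ((d : ℝ) + 1) * L) := by field_simp
    rw [h2] at h1
    exact h1.trans ((div_le_one hM0).2 hM1)
  refine (norm_avgIter_quot_sub_one_le hL hT hV hV' hε0 hε hW k hB hc).trans ?_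
  have habs : |t| ≤ 1 := by rwa [abs_of_nonneg ht0]
  have h := Real.abs_exp_sub_one_sub_id_le habs
  have h' : Real.exp t - 1 - t ≤ t ^ 2 := (le_abs_self _).trans h
  nlinarith

end Power

end Summit.QuantumFields.BalabanUV.T4Continuum.ShellMeasureAverageIteratePower

end
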